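import Literature.MathematicalPhysics.QuantumFieldTheory.Balaban1983to89.B11Eq98V0LettersFlat

/-!
# `Balaban1983to89.B11Eq98V0LettersFlatLevels` — T. Bałaban, *The variational problem and background fields in renormalization group method for
# lattice gauge theories*, Commun. Math. Phys. **102** (1985) 277–309 [Balaban1985Variational]: p. 286 (the multi-level sizes `|·|₍₋ₙ₎`), (115) p. 294,
# (144) p. 300 (the cube sequence), (98) p. 293 — THE LEVEL-GEOMETRY LETTER `Λ` OF THE V₀-GROUP's (98)-SLOT IS `L²` FOR SITE-LEVEL MAPS OF ONE-STEP
# OSCILLATION ≤ 1, and the level map `j(x)` of a nested family whose domains carry a one-step collar has that oscillation; hence the V₀-group's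
# (98)-slot at the FLAT background on MULTI-LEVEL weights `(L^{j(b₋)}η)ⁿ` with a LETTER-FREE constant

statement-level skeleton of published theorems with citation tags; proofs where landed; nothing here is a claim about the Yang–Mills mass gap

THE PRINT.  p. 286: *«sup_j Lʲη sup_{Ω_j}|A′| = |A′|₍₋₁₎»* — the weight of a bond is `(Lʲη)ⁿ` with `j` the level of the domain it lies in; p. 300 (144):
*«□₀ ⊃ □₁ ⊃ … ⊃ □_k ⊃ □, dist(□_{n+1}, □_nᶜ) = R₁M₁Lⁿη»* — consecutive cubes are separated by at least one lattice step, so the level `j(x)` (the largest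
`j` with `x ∈ □_j`, lit-balaban's `B11Eq115Space.levOf`) changes by at most one across a lattice step; p. 293: *«The constants a₃, C₄ depend on d and L only.»*

WHY THIS FILE (cell `pub-ymgap`, width seat `pub-ymgap-k0-s1-w2`, K0⁷ stub 1 `stub_prop8StepCoP13`, sub-target S4b).  `B11Eq98V0LettersFlat.quadAnalytic_curV0_flat`
(this seat) gives the V₀-group's (98)-slot at the flat background with a constant reading `d`, `‖ρ‖`, `‖τ‖` and the level-geometry letter `Λ` of
`B11Eq63V0GroupCurrent.quadAnalytic_curV0` (three displays comparing the weight of a bond with the weights of its plaquettes ∕ neighbours ∕ derivative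
slots); `levelGeometry_const` there settles ONE level (`Λ = 1`).  Sect. F reads the sizes on the CUBE SEQUENCE (144) with level-DEPENDENT weights; the route
`UnitScaleTilt`'s reading of (115)/(158) on a domain sequence (`Thm/UnitScaleTiltProp8FlatSmallSolution158CubeSeq`: `w m b = (L^{levOf Ω k b₋}·η)^m`) indexes
the weight of a bond by the level of its SOURCE site.  THIS FILE: for any site-level map `ℓ` whose value changes by at most one across a lattice step, the
three displays hold with `Λ = L²` (a bond and the bonds of its plaquettes have sources within two steps); `levOf Ω k` has that property whenever each
`Ω_{j+1}` has its one-step neighbourhood inside `Ω_j`; so the flat V₀-slot holds on such weights with the letter-free constant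
`64(d−1)L⁶‖ρ‖ + (d−1)L⁶(136 + 2L²)‖ρ‖‖τ‖`.

WHAT IS PROVED (sorry-free; axioms standard; 0 `def`, no new named fact; [folklore] lattice bookkeeping + instantiation of this seat's flat slot).
* §1 `pow_mul_le_sq_mul_of_le_add_two`; **`levelGeometry_of_siteLevel`** — the three level-geometry displays with `Λ = L²` for `lev₀ b := ℓ b.1`,
  `lev₁ p := ℓ p.1.1`, `ℓ` of one-step oscillation ≤ 1 (`1 ≤ L`, `0 ≤ η`).
* §2 **`levOf_osc_of_collar`** — `levOf Ω k (T_ν x) ≤ levOf Ω k x + 1 ∧ levOf Ω k x ≤ levOf Ω k (T_ν x) + 1` when `x ∈ Ω_{j+1} ⇒ T_ν^{±1} x ∈ Ω_j`.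
* §3 **`quadAnalytic_curV0_flat_siteLevel`** — `QuadAnalytic (curV0 ρ τ 1) (64(d−1)(L²)³‖ρ‖ + (d−1)(L²)³(136 + 2L²)‖ρ‖‖τ‖) (1/16)` on the weights of a
  site-level map of oscillation ≤ 1; **`quadAnalytic_curV0_flat_levOf`** — the same on the weights `levOf Ω k (·)₋` of a collared nested family;
  `curV0_flat_levOf_quadBound` — the pointwise `hqV` form; **`quadAnalytic_curV0_of_class14_levOf`** — the (14)-class (non-flat) reading on the
  same weights, only letter `s` (print's `C₁B₃ε₁`).
* §4 **`prop4Hyp_curV0_of_quadAnalytic`** (any background: the V₀-group current is entire, so `QuadAnalytic ⇒ Prop4Hyp`, the Fréchet form the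
  contraction consumes), **`prop4Hyp_curV0_flat_levOf`**.
HONEST SCOPE.  (i) V₀-group only, flat background only (the (14)-class version is `B11Eq98V0LettersFlat.quadAnalytic_curV0_of_class14` with the same `Λ`).
(ii) The collar hypothesis is the ONE-STEP form of (144)'s separation; identifying the tree's cube sequence ∕ (2.18) sequences with it is the consumer's
line (their `dist ≥ R₁M₁Lⁿ ≥ 1`).  (iii) NOT a discharge of N07 ∕ K0⁷; count-neutral; NOT continuum ∕ OS ∕ mass gap ∕ Clay.  Imports `B11Eq98V0LettersFlat`
ONLY; modifies nothing.
-/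

noncomputable section

namespace Literature.MathematicalPhysics.QuantumFieldTheory.Balaban1983to89.B11Eq98V0LettersFlatLevels

open Literature.MathematicalPhysics.QuantumFieldTheory.Balaban1983to89.B9Eq39Adjoint (posPlaq plaqU mem_posPlaq)
open Literature.MathematicalPhysics.QuantumFieldTheory.Balaban1983to89.B11Eq90StB (st)
open Literature.MathematicalPhysics.QuantumFieldTheory.Balaban1983to89.B11Eq90V0primeBond (plaqWeight plaqWeight_pos)
open Literature.MathematicalPhysics.QuantumFieldTheory.Balaban1983to89.B11Eq90V0primeCurrent (Tsh Ucur)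
open Literature.MathematicalPhysics.QuantumFieldTheory.Balaban1983to89.B11Eq63V0GroupCurrent (curV0)
open Literature.MathematicalPhysics.QuantumFieldTheory.Balaban1983to89.B11Eq90V0primeCurrent (differentiable_curV0prime)
open Literature.MathematicalPhysics.QuantumFieldTheory.Balaban1983to89.B11Eq96CommutatorCurrent (differentiable_curComm)
open Literature.MathematicalPhysics.QuantumFieldTheory.Balaban1983to89.B11Prop6Scheme (Prop4Hyp)
open Literature.MathematicalPhysics.QuantumFieldTheory.Balaban1983to89.B11Eq98V0LettersFlat (quadAnalytic_curV0_flat quadAnalytic_curV0_of_class14)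
open Literature.MathematicalPhysics.QuantumFieldTheory.Balaban1983to89.B13Contraction113 (QuadAnalytic)
open B9SectCLatticeCarrier (Bond)
open B4Sect5Torus (TSite)
open B11Eq115Space
open B11Eq111FrakG (nabla115)

variable {d : ℕ} {Pd : Fin d → ℕ} {L η : ℝ}

/-! ## §1 Site-level maps of one-step oscillation ≤ 1: the level-geometry letter is `Λ = L²` -/

/-- Weights two levels apart compare by `L²`: `a ≤ b + 2 ⇒ Lᵃη ≤ L²·(Lᵇη)` (`1 ≤ L`, `0 ≤ η`). [folklore] [cite: Balaban1985Variational, p.286] -/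
theorem pow_mul_le_sq_mul_of_le_add_two (hL : 1 ≤ L) (hη : 0 ≤ η) {a b : ℕ} (h : a ≤ b + 2) :
    L ^ a * η ≤ L ^ 2 * (L ^ b * η) := by
  have h1 : L ^ a ≤ L ^ (b + 2) := pow_le_pow_right₀ hL h
  calc L ^ a * η ≤ L ^ (b + 2) * η := mul_le_mul_of_nonneg_right h1 hη
    _ = L ^ 2 * (L ^ b * η) := by ring

/-- **THE THREE LEVEL-GEOMETRY DISPLAYS OF `quadAnalytic_curV0` WITH `Λ = L²` FOR A SITE-LEVEL MAP OF ONE-STEP OSCILLATION ≤ 1**: bond weights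
`w₁(x, μ) = L^{ℓ(x)}η`, pair weights `w₂((x, κ), κ″) = (L^{ℓ(x)}η)²`; the bonds of a plaquette containing `(x₀, μ₀)` have sources `y`, `T_{μ′}y`, `T_{ν′}y`
with `y ∈ {x₀, T⁻¹x₀}`, i.e. within two steps of `x₀`, so every ratio is at most `L²`. [folklore] [cite: Balaban1985Variational, p.286, (90)–(96) pp.291–292] -/
theorem levelGeometry_of_siteLevel (hL : 1 ≤ L) (hη : 0 ≤ η) (ℓ : TSite d Pd → ℕ)
    (hℓ : ∀ (x : TSite d Pd) (ν : Fin d), ℓ (Tsh ν x) ≤ ℓ x + 1 ∧ ℓ x ≤ ℓ (Tsh ν x) + 1) :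
    (∀ q ∈ posPlaq (TSite d Pd) (Fin d), ∀ (μ₀ : Fin d) (x₀ : TSite d Pd), q ∈ st Tsh μ₀ x₀ →
      levWeight L η (fun b : Bond d Pd => ℓ b.1) 1 (x₀, μ₀) ≤ L ^ 2 * plaqWeight Tsh (levWeight L η (fun b : Bond d Pd => ℓ b.1) 1) q) ∧
    (∀ (x₀ : TSite d Pd) (μ₀ ν : Fin d) (y : TSite d Pd), (y = x₀ ∨ y = (Tsh ν).symm x₀) →
      levWeight L η (fun b : Bond d Pd => ℓ b.1) 1 (x₀, μ₀) ≤ L ^ 2 * levWeight L η (fun b : Bond d Pd => ℓ b.1) 1 (y, μ₀) ∧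
        levWeight L η (fun b : Bond d Pd => ℓ b.1) 1 (x₀, μ₀) ≤ L ^ 2 * levWeight L η (fun b : Bond d Pd => ℓ b.1) 1 (y, ν)) ∧
    (∀ (x₀ : TSite d Pd) (μ₀ ν : Fin d) (y : TSite d Pd), (y = x₀ ∨ y = (Tsh ν).symm x₀) →
      ∀ κ κ'' : Fin d, (κ = μ₀ ∨ κ = ν) → (κ'' = μ₀ ∨ κ'' = ν) →
        levWeight L η (fun b : Bond d Pd => ℓ b.1) 1 (x₀, μ₀) ^ 2
          ≤ (L ^ 2) ^ 2 * levWeight L η (fun p : Bond d Pd × Fin d => ℓ p.1.1) 2 ((y, κ), κ'')) := by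
  -- one step: `ℓ x₀ ≤ ℓ y + 1` for `y = x₀` or `T_ν y = x₀`
  have step : ∀ (x₀ y : TSite d Pd) (ν : Fin d), (y = x₀ ∨ y = (Tsh ν).symm x₀) → ℓ x₀ ≤ ℓ y + 1 := by
    rintro x₀ y ν (rfl | rfl)
    · exact Nat.le_succ _
    · have h := (hℓ ((Tsh ν).symm x₀) ν).1
      rwa [Equiv.apply_symm_apply] at h
  have cmp : ∀ (a b : ℕ), a ≤ b + 2 → (L ^ a * η) ^ 1 ≤ L ^ 2 * (L ^ b * η) ^ 1 := fun a b h => by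
    simpa only [pow_one] using pow_mul_le_sq_mul_of_le_add_two hL hη h
  refine ⟨fun q hq μ₀ x₀ hst => ?_, fun x₀ μ₀ ν y hy => ?_, fun x₀ μ₀ ν y hy κ κ'' _ _ => ?_⟩
  · -- the four bonds of `q` have sources `q.1`, `T_{μ'} q.1`, `T_{ν'} q.1`, within two steps of `x₀`
    have hq1 : ℓ x₀ ≤ ℓ q.1 + 1 := by
      rw [st, Finset.mem_filter] at hst
      rcases hst.2 with ⟨_, h | h⟩ | ⟨_, h | h⟩
      · rw [← h]; exact (hℓ q.1 q.2.2).1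
      · rw [← h]; exact Nat.le_succ _
      · rw [← h]; exact Nat.le_succ _
      · rw [← h]; exact (hℓ q.1 q.2.1).1
    have hT : ∀ κ : Fin d, ℓ x₀ ≤ ℓ (Tsh κ q.1) + 2 := fun κ =>
      hq1.trans (by have := (hℓ q.1 κ).2; omega)
    have h0 : ℓ x₀ ≤ ℓ q.1 + 2 := hq1.trans (Nat.le_succ _)
    have hL2 : (0 : ℝ) ≤ L ^ 2 := pow_nonneg (zero_le_one.trans hL) 2
    simp only [levWeight, plaqWeight]
    rw [mul_min_of_nonneg _ _ hL2, mul_min_of_nonneg _ _ hL2, mul_min_of_nonneg _ _ hL2]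
    exact le_min (le_min (cmp _ _ h0) (cmp _ _ (hT _))) (le_min (cmp _ _ (hT _)) (cmp _ _ h0))
  · have h := step x₀ y ν hy
    simp only [levWeight]
    exact ⟨cmp _ _ (h.trans (Nat.le_succ _)), cmp _ _ (h.trans (Nat.le_succ _))⟩
  · have h := step x₀ y ν hy
    have hw : L ^ ℓ x₀ * η ≤ L ^ 2 * (L ^ ℓ y * η) := pow_mul_le_sq_mul_of_le_add_two hL hη (h.trans (Nat.le_succ _))
    have hnn : 0 ≤ L ^ ℓ x₀ * η := mul_nonneg (pow_nonneg (zero_le_one.trans hL) _) hη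
    simp only [levWeight, pow_one]
    calc (L ^ ℓ x₀ * η) ^ 2 ≤ (L ^ 2 * (L ^ ℓ y * η)) ^ 2 := pow_le_pow_left₀ hnn hw 2
      _ = (L ^ 2) ^ 2 * (L ^ ℓ y * η) ^ 2 := by ring

/-! ## §2 The level map `levOf` of a collared nested family has one-step oscillation ≤ 1 -/

open Classical in
/-- **`levOf` OSCILLATES BY AT MOST ONE ACROSS A LATTICE STEP** when each `Ω_{j+1}` has its one-step neighbourhood inside `Ω_j` (the one-step form of
(144)'s separation `dist(□_{n+1}, □_nᶜ) = R₁M₁Lⁿη ≥ η`): if `levOf x = j′ + 1` then `x ∈ Ω_{j′+1}`, so `T_ν^{±1}x ∈ Ω_{j′}` and `levOf (T_ν^{±1}x) ≥ j′`.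
[cite: Balaban1985Variational, (144) p.300, p.286] -/
theorem levOf_osc_of_collar {Ω : ℕ → Set (TSite d Pd)} (k : ℕ)
    (hcollar : ∀ (j : ℕ) (x : TSite d Pd) (ν : Fin d), x ∈ Ω (j + 1) → Tsh ν x ∈ Ω j ∧ (Tsh ν).symm x ∈ Ω j)
    (x : TSite d Pd) (ν : Fin d) :
    levOf Ω k (Tsh ν x) ≤ levOf Ω k x + 1 ∧ levOf Ω k x ≤ levOf Ω k (Tsh ν x) + 1 := by
  have gen : ∀ x y : TSite d Pd, (∀ j, x ∈ Ω (j + 1) → y ∈ Ω j) → levOf Ω k x ≤ levOf Ω k y + 1 := by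
    intro x y hxy
    rcases Nat.eq_zero_or_pos (levOf Ω k x) with h0 | hpos
    · rw [h0]; exact Nat.zero_le _
    · obtain ⟨j', hj'⟩ : ∃ j', levOf Ω k x = j' + 1 := ⟨levOf Ω k x - 1, by omega⟩
      have hxmem : x ∈ Ω (j' + 1) := Nat.findGreatest_of_ne_zero hj' (Nat.succ_ne_zero _)
      have hy : y ∈ Ω j' := hxy j' hxmem
      have hjk : j' ≤ k := by have := levOf_le Ω k x; omega
      have := le_levOf (Ω := Ω) hjk hy
      omega
  exact ⟨gen _ _ fun j hj => by simpa using (hcollar j _ ν hj).2, gen _ _ fun j hj => (hcollar j x ν hj).1⟩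

/-! ## §3 The V₀-group's (98)-slot at the flat background on multi-level weights, letter-free -/

variable [Fact (0 < L)] [Fact (0 < η)]
variable {𝔸 : Type*} [NormedRing 𝔸] [NormedAlgebra ℂ 𝔸] [CompleteSpace 𝔸] [NormOneClass 𝔸] [StarRing 𝔸] [StarModule ℂ 𝔸]

/-- **THE FLAT V₀-SLOT ON THE WEIGHTS OF A SITE-LEVEL MAP OF OSCILLATION ≤ 1, NO LETTER LEFT**: for `lev₀ b := ℓ b.1`, `lev₁ p := ℓ p.1.1` with `ℓ` of
one-step oscillation ≤ 1, a tracial `*`-compatible contractive trace `τ` and `1 ≤ L`: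
`QuadAnalytic (curV0 ρ τ 1) (64(d−1)(L²)³‖ρ‖ + (d−1)(L²)³(136 + 2L²)‖ρ‖‖τ‖) (1/16)` — uniform in the lattice, in `ℓ` and in `η`.
[cite: Balaban1985Variational, (98) p.293, Prop. 4 p.293 («depend on d and L only»), p.302] -/
theorem quadAnalytic_curV0_flat_siteLevel (ρ : (𝔸 →L[ℂ] ℂ) →L[ℂ] 𝔸) (τ : 𝔸 →L[ℂ] ℂ)
    (hτ : ∀ a b : 𝔸, τ (a * b) = τ (b * a)) (hτs : ∀ a : 𝔸, τ (star a) = starRingEnd ℂ (τ a)) (hτ1 : ∀ X : 𝔸, ‖τ X‖ ≤ ‖X‖) (hL : 1 ≤ L)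
    (ℓ : TSite d Pd → ℕ) (hℓ : ∀ (x : TSite d Pd) (ν : Fin d), ℓ (Tsh ν x) ≤ ℓ x + 1 ∧ ℓ x ≤ ℓ (Tsh ν x) + 1) :
    QuadAnalytic (curV0 (L := L) (η := η) (lev₀ := fun b : Bond d Pd => ℓ b.1) (lev₁ := fun p : Bond d Pd × Fin d => ℓ p.1.1)
        (Dc := nabla115 η (1 : Bond d Pd → 𝔸ˣ)) ρ τ 1)
      (64 * ((d - 1 : ℕ) : ℝ) * (L ^ 2) ^ 3 * ‖ρ‖ + ((d - 1 : ℕ) : ℝ) * (L ^ 2) ^ 3 * (136 + 2 * L ^ 2) * ‖ρ‖ * ‖τ‖) (1 / 16) := by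
  have hη : (0 : ℝ) < η := Fact.out
  obtain ⟨hΛ, hΛa, hΛ'⟩ := levelGeometry_of_siteLevel (d := d) (Pd := Pd) (L := L) (η := η) hL hη.le ℓ hℓ
  have hL2 : (1 : ℝ) ≤ L ^ 2 := one_le_pow₀ hL
  exact quadAnalytic_curV0_flat (lev₀ := fun b : Bond d Pd => ℓ b.1) (lev₁ := fun p : Bond d Pd × Fin d => ℓ p.1.1) ρ τ hτ hτs hτ1 hL
    (Λ := L ^ 2) hL2 hΛ hΛa hΛ'

open Classical in
/-- **THE FLAT V₀-SLOT ON THE WEIGHTS `(L^{levOf Ω k b₋}η)ⁿ` OF A COLLARED NESTED FAMILY, NO LETTER LEFT** — the reading of the sizes on the cube sequence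
(144) ∕ a separated domain sequence (each `Ω_{j+1}` with its one-step neighbourhood inside `Ω_j`); constant `64(d−1)L⁶‖ρ‖ + (d−1)L⁶(136 + 2L²)‖ρ‖‖τ‖`
at radius `1/16`. [cite: Balaban1985Variational, (98) p.293, (144) p.300, (115) p.294, p.302] -/
theorem quadAnalytic_curV0_flat_levOf (ρ : (𝔸 →L[ℂ] ℂ) →L[ℂ] 𝔸) (τ : 𝔸 →L[ℂ] ℂ)
    (hτ : ∀ a b : 𝔸, τ (a * b) = τ (b * a)) (hτs : ∀ a : 𝔸, τ (star a) = starRingEnd ℂ (τ a)) (hτ1 : ∀ X : 𝔸, ‖τ X‖ ≤ ‖X‖) (hL : 1 ≤ L)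
    (Ω : ℕ → Set (TSite d Pd)) (k : ℕ)
    (hcollar : ∀ (j : ℕ) (x : TSite d Pd) (ν : Fin d), x ∈ Ω (j + 1) → Tsh ν x ∈ Ω j ∧ (Tsh ν).symm x ∈ Ω j) :
    QuadAnalytic (curV0 (L := L) (η := η) (lev₀ := fun b : Bond d Pd => levOf Ω k b.1) (lev₁ := fun p : Bond d Pd × Fin d => levOf Ω k p.1.1)
        (Dc := nabla115 η (1 : Bond d Pd → 𝔸ˣ)) ρ τ 1)
      (64 * ((d - 1 : ℕ) : ℝ) * (L ^ 2) ^ 3 * ‖ρ‖ + ((d - 1 : ℕ) : ℝ) * (L ^ 2) ^ 3 * (136 + 2 * L ^ 2) * ‖ρ‖ * ‖τ‖) (1 / 16) :=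
  quadAnalytic_curV0_flat_siteLevel ρ τ hτ hτs hτ1 hL (levOf Ω k) (fun x ν => levOf_osc_of_collar k hcollar x ν)

open Classical in
/-- The pointwise `hqV` form of `quadAnalytic_curV0_flat_levOf`: `‖Y‖ < 1/16 → ‖curV0 ρ τ 1 Y‖₍₋₃₎ ≤ C·‖Y‖²`. [cite: Balaban1985Variational, (98) p.293] -/
theorem curV0_flat_levOf_quadBound (ρ : (𝔸 →L[ℂ] ℂ) →L[ℂ] 𝔸) (τ : 𝔸 →L[ℂ] ℂ)
    (hτ : ∀ a b : 𝔸, τ (a * b) = τ (b * a)) (hτs : ∀ a : 𝔸, τ (star a) = starRingEnd ℂ (τ a)) (hτ1 : ∀ X : 𝔸, ‖τ X‖ ≤ ‖X‖) (hL : 1 ≤ L)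
    (Ω : ℕ → Set (TSite d Pd)) (k : ℕ)
    (hcollar : ∀ (j : ℕ) (x : TSite d Pd) (ν : Fin d), x ∈ Ω (j + 1) → Tsh ν x ∈ Ω j ∧ (Tsh ν).symm x ∈ Ω j)
    (Y : Space115 L η (fun b : Bond d Pd => levOf Ω k b.1) (fun p : Bond d Pd × Fin d => levOf Ω k p.1.1) (nabla115 η (1 : Bond d Pd → 𝔸ˣ)))
    (hY : ‖Y‖ < 1 / 16) :
    ‖curV0 (lev₁ := fun p : Bond d Pd × Fin d => levOf Ω k p.1.1) (Dc := nabla115 η (1 : Bond d Pd → 𝔸ˣ)) ρ τ 1 Y‖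
      ≤ (64 * ((d - 1 : ℕ) : ℝ) * (L ^ 2) ^ 3 * ‖ρ‖ + ((d - 1 : ℕ) : ℝ) * (L ^ 2) ^ 3 * (136 + 2 * L ^ 2) * ‖ρ‖ * ‖τ‖) * ‖Y‖ ^ 2 :=
  (quadAnalytic_curV0_flat_levOf ρ τ hτ hτs hτ1 hL Ω k hcollar).quad Y hY


open Classical in
/-- **THE (14)-CLASS V₀-SLOT ON THE WEIGHTS OF A COLLARED NESTED FAMILY** (any unitary unit-bounded background whose plaquette variables carry the
class letter `‖U₀(∂q) − 1‖ ≤ s·η²/w_∂(q)²`; `Λ = L²` by §1–§2): `QuadAnalytic (curV0 ρ τ U₀) (1024(d−1)L⁶‖ρ‖(s + s²/2 + 1/16) + (d−1)L⁶(136 + 2L²)‖ρ‖‖τ‖) (1/16)`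
— the non-flat reading (Sects. B–E at a background (14)) with the only letter left being print's `s = C₁B₃ε₁`.
[cite: Balaban1985Variational, (98) p.293, (14) p.280, (38) p.284, (115) p.294] -/
theorem quadAnalytic_curV0_of_class14_levOf (ρ : (𝔸 →L[ℂ] ℂ) →L[ℂ] 𝔸) (τ : 𝔸 →L[ℂ] ℂ)
    (hτ : ∀ a b : 𝔸, τ (a * b) = τ (b * a)) (hτs : ∀ a : 𝔸, τ (star a) = starRingEnd ℂ (τ a)) (hτ1 : ∀ X : 𝔸, ‖τ X‖ ≤ ‖X‖) (hL : 1 ≤ L)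
    (Ω : ℕ → Set (TSite d Pd)) (k : ℕ)
    (hcollar : ∀ (j : ℕ) (x : TSite d Pd) (ν : Fin d), x ∈ Ω (j + 1) → Tsh ν x ∈ Ω j ∧ (Tsh ν).symm x ∈ Ω j)
    (U₀ : Bond d Pd → 𝔸ˣ) (hU : ∀ b, (((U₀ b)⁻¹ : 𝔸ˣ) : 𝔸) = star (U₀ b : 𝔸))
    (hUn : ∀ b, ‖(U₀ b : 𝔸)‖ ≤ 1 ∧ ‖(((U₀ b)⁻¹ : 𝔸ˣ) : 𝔸)‖ ≤ 1) {s : ℝ} (hs : 0 ≤ s)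
    (h14 : ∀ q ∈ posPlaq (TSite d Pd) (Fin d),
      ‖(plaqU Tsh (Ucur U₀) q.2.1 q.2.2 q.1 : 𝔸) - 1‖
        ≤ s * (η ^ 2 / plaqWeight Tsh (levWeight L η (fun b : Bond d Pd => levOf Ω k b.1) 1) q ^ 2)) :
    QuadAnalytic (curV0 (L := L) (η := η) (lev₀ := fun b : Bond d Pd => levOf Ω k b.1) (lev₁ := fun p : Bond d Pd × Fin d => levOf Ω k p.1.1)
        (Dc := nabla115 η U₀) ρ τ U₀)
      (1024 * ((d - 1 : ℕ) : ℝ) * (L ^ 2) ^ 3 * ‖ρ‖ * ((s + s ^ 2 / 2) + 1 / 16)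
        + ((d - 1 : ℕ) : ℝ) * (L ^ 2) ^ 3 * (136 + 2 * L ^ 2) * ‖ρ‖ * ‖τ‖) (1 / 16) := by
  have hη : (0 : ℝ) < η := Fact.out
  obtain ⟨hΛ, hΛa, hΛ'⟩ := levelGeometry_of_siteLevel (d := d) (Pd := Pd) (L := L) (η := η) hL hη.le (levOf Ω k)
    (fun x ν => levOf_osc_of_collar k hcollar x ν)
  exact quadAnalytic_curV0_of_class14 (lev₀ := fun b : Bond d Pd => levOf Ω k b.1) (lev₁ := fun p : Bond d Pd × Fin d => levOf Ω k p.1.1)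
    ρ τ hτ hτs hτ1 hL U₀ hU hUn hs (one_le_pow₀ hL) hΛ hΛa hΛ' h14


/-! ## §4 The Fréchet form (`Prop4Hyp`): the V₀-group current is entire, so every `QuadAnalytic` slot upgrades -/

omit [NormOneClass 𝔸] [StarRing 𝔸] [StarModule ℂ 𝔸] in
/-- **`QuadAnalytic ⇒ Prop4Hyp` FOR THE V₀-GROUP CURRENT** (any background): `curV0 = curV0prime + curComm` is differentiable on the whole (115)
space (both summands are polynomial in the bond letters: `differentiable_curV0prime`, `differentiable_curComm`), so the quadratic slot alone gives
Prop. 4's Fréchet form *«The functional derivative of V(A′) is an analytic function on this space»* — the `hWd`∕`differentiableOn` input of the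
Sect. E∕F contraction (`B11Prop6Scheme.eq158_solution`, `Thm/UnitScaleTiltProp8FlatSmallSolution158`). [cite: Balaban1985Variational, Prop. 4 p.292, (98) p.293] -/
theorem prop4Hyp_curV0_of_quadAnalytic {lev₀ : Bond d Pd → ℕ} {lev₁ : Bond d Pd × Fin d → ℕ} (ρ : (𝔸 →L[ℂ] ℂ) →L[ℂ] 𝔸) (τ : 𝔸 →L[ℂ] ℂ)
    (U₀ : Bond d Pd → 𝔸ˣ) {C R : ℝ}
    (hq : QuadAnalytic (curV0 (L := L) (η := η) (lev₀ := lev₀) (lev₁ := lev₁) (Dc := nabla115 η U₀) ρ τ U₀) C R) :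
    Prop4Hyp (curV0 (L := L) (η := η) (lev₀ := lev₀) (lev₁ := lev₁) (Dc := nabla115 η U₀) ρ τ U₀) C R where
  quad := hq.quad
  differentiableOn :=
    ((differentiable_curV0prime (lev₁ := lev₁) (Dc := nabla115 η U₀) ρ τ U₀).add
      (differentiable_curComm (lev₁ := lev₁) (Dc := nabla115 η U₀) ρ τ U₀)).differentiableOn

open Classical in
/-- **PROP. 4's FRÉCHET FORM FOR THE V₀-GROUP AT THE FLAT BACKGROUND ON THE WEIGHTS OF A COLLARED NESTED FAMILY, NO LETTER LEFT**:
`Prop4Hyp (curV0 ρ τ 1) (64(d−1)L⁶‖ρ‖ + (d−1)L⁶(136 + 2L²)‖ρ‖‖τ‖) (1/16)`. [cite: Balaban1985Variational, Prop. 4 p.292, (98) p.293, p.302] -/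
theorem prop4Hyp_curV0_flat_levOf (ρ : (𝔸 →L[ℂ] ℂ) →L[ℂ] 𝔸) (τ : 𝔸 →L[ℂ] ℂ)
    (hτ : ∀ a b : 𝔸, τ (a * b) = τ (b * a)) (hτs : ∀ a : 𝔸, τ (star a) = starRingEnd ℂ (τ a)) (hτ1 : ∀ X : 𝔸, ‖τ X‖ ≤ ‖X‖) (hL : 1 ≤ L)
    (Ω : ℕ → Set (TSite d Pd)) (k : ℕ)
    (hcollar : ∀ (j : ℕ) (x : TSite d Pd) (ν : Fin d), x ∈ Ω (j + 1) → Tsh ν x ∈ Ω j ∧ (Tsh ν).symm x ∈ Ω j) :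
    Prop4Hyp (curV0 (L := L) (η := η) (lev₀ := fun b : Bond d Pd => levOf Ω k b.1) (lev₁ := fun p : Bond d Pd × Fin d => levOf Ω k p.1.1)
        (Dc := nabla115 η (1 : Bond d Pd → 𝔸ˣ)) ρ τ 1)
      (64 * ((d - 1 : ℕ) : ℝ) * (L ^ 2) ^ 3 * ‖ρ‖ + ((d - 1 : ℕ) : ℝ) * (L ^ 2) ^ 3 * (136 + 2 * L ^ 2) * ‖ρ‖ * ‖τ‖) (1 / 16) :=
  prop4Hyp_curV0_of_quadAnalytic ρ τ 1 (quadAnalytic_curV0_flat_levOf ρ τ hτ hτs hτ1 hL Ω k hcollar)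

end Literature.MathematicalPhysics.QuantumFieldTheory.Balaban1983to89.B11Eq98V0LettersFlatLevels

end
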